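import Summits.HodgeConjecture.CorCM.WeilLineMonomials
import Literature.AlgebraicGeometry.Deligne1982.WeilClassesCMFamilyDivisorCriterion
import HarnessLib

/-!
# COR-CM (cell `pub-hodgecm2`): Deligne's Weil space `⋀^{2m}_K H¹(⨁_j A_j) ⊗ ℂ` IS the sum of the
# Pohlmann-coordinate Weil weight lines — the `K`-Weil-line space of André's product form equals
# `⨆_s H^{2m}(B)_{Δ×{s}}`

HONEST FRAMING (cell pub-hodgecm2 / COR-CM, literature typer `lit-deligne`; count-neutral: no binder row,
no named fact, nothing about algebraic cycles is asserted and no case of the Hodge conjecture is proved).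
This file closes the one residual recorded in the cell's Deligne binder table
(`run/shared/lean/pub/pub-hodgecm2/lit/deligne82.md`, row 36, "Not done: the reverse inclusion
`weilLineClasses ≤ ⨆_s weightClassesAlg (weilWeight m s)`").

Setting ([Deligne1982HodgeCycles, I §5 (c), pp. 38–39]: "Let `(Φ_i)_{1≤i≤d}` be a family of CM-types …
`A = ⊕ A_i` … `⋀^d_E H¹(A, ℚ)(d/2) ⊂ H^d(A, ℚ)(d/2)`"): a number field `K`, `2m` complex abelian varieties
`A_j` with `𝓞_K`-actions `ι_j` read on `H¹` through `θ_j` and realising CM types `Φ_j`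
(`ComplexMultiplication.IsCMTypeRealisation`), `B = ⨁_{j<2m} A_j` with the DIAGONAL `𝓞_K`-action.  Two
tree objects describe Deligne's space `⋀^{2m}_K H¹(B, ℚ) ⊗ ℂ ⊆ H^{2m}(B(ℂ); ℂ)`:

* the `K`-Weil-line space of André's product form / Milne's `W_F(A_Δ)`,
  `HodgeTheory.weilLineClasses B ι (2m) = ⨆_s ⋂_{a ∈ 𝓞_K} {x | a^* x = s(a)^{2m} x}` (eigen-condition for the
  DIAGONAL action only; `HodgeTheory/WeilClassesCMReductionProductForm`), and
* the Pohlmann weight classes of the WEIL WEIGHTS `Δ × {s} = weilWeight m s`,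
  `Pohlmann1968.weightClassesAlg B ι (2m) (weilWeight m s) = {x | (⊕_j ι_j(a_j))^* x = (∏_j s(a_j)) x ∀ (a_j)_j}`
  (eigen-condition for the full torus `∏_j 𝓞_K`; `Deligne1982/WeilClassesCMFamilyDivisorCriterion`), each a LINE
  (`Deligne1982.finrank_weightClassesAlg_weilWeight`).

The tree had `weightClassesAlg (weilWeight m s) ≤ weilLineClasses`
(`Deligne1982.weightClassesAlg_weilWeight_le_weilLineClasses`) and, separately, p2's monomial description
`weilLineClasses = ⨆_s ℂ · μ_s` (`WeilLineMonomial.weilLineClasses_eq_iSup_span_monomial`: a simultaneous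
eigenvector of the diagonal action with character `s^{2m}` is a multiple of the monomial `μ_s`, by separation of
the monomial characters `∏_{(j,σ)∈S} σ` on `𝓞_K`).  Results, all PROVED:

* `map_torus_biprodBasis`, `map_torus_monomial` — the full torus `(a_j)_j ∈ ∏_j 𝓞_K` acts on the eigen-line
  `(j, σ)` of `H¹(B)` by `σ(a_j)` and on the monomial `μ_s` by `∏_j s(a_j)`;
* `monomial_mem_weightClassesAlg_weilWeight`, **`span_monomial_eq_weightClassesAlg_weilWeight`** —
  `ℂ · μ_s = H^{2m}(B)_{Δ×{s}}` (inclusion + both are lines);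
* **`weilLineClasses_eq_iSup_weightClassesAlg_weilWeight`** — for every family of realisations,
  `weilLineClasses B ι (2m) = ⨆_s weightClassesAlg B ι (2m) (weilWeight m s)` (statement free of eigenbases);
* consequences for the WHOLE Weil space (previously known line by line): under Deligne's constant-sum
  hypothesis `Σ_j Φ_j = m` it lies in `Bᵐ(B) ⊗ ℂ` (`weilLineClasses_le_hodgeClassSpan`, §5 (c) "In summary",
  Hodge part); it lies in the divisor part `Dᵐ(B) ⊗ ℂ` iff `d(Ψ) = d(Ψ̄)` for every type `Ψ`
  (`weilLineClasses_le_divisorClassesSpan_iff`, the family form of "the Weil classes are exotic",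
  [Gordon1999HodgeAVSurvey, 9.2.2]), one divisorial Weil line forces all (`…_of_weightClassesAlg_le`);
  otherwise the whole Weil space MEETS `Dᵐ(B) ⊗ ℂ` TRIVIALLY (`disjoint_weilLineClasses_divisorClassesSpan`,
  `weilLineClasses_le_or_disjoint_divisorClassesSpan`, `weilLineClasses_exotic`: two disjoint sub-families of one
  cup-monomial eigenbasis); `dim_ℂ = [K:ℚ]` (`finrank_weilLineClasses_eq`), `≠ ⊥` (`weilLineClasses_ne_bot`).

For André's record (`HodgeTheory.Andre1992_hodgeClasses_cmTypedProduct_mem_span_pullback_weilLines`, discharged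
in `CorCM/AndreProductFormHolds`) this says: the generating classes `f_Δ^* ω`, `ω ∈ weilLineClasses (B_Δ)`, of a
twisted slot product `B_Δ` (slots realising `Φ_{i_j}^{e_j}`, `HodgeTheory.slot_isCMTypeRealisation`) are sums of
classes in the `[K:ℚ]` Pohlmann weight lines of the Weil weights of `B_Δ` — apply
`weilLineClasses_eq_iSup_weightClassesAlg_weilWeight` to `fun j => slot_isCMTypeRealisation (hA (i j)) (e j)`.

References: [Deligne1982HodgeCycles] P. Deligne, *Hodge cycles on abelian varieties*, LNM 900 (1982), I Prop. 4.4
(p. 30), §5 (c) (pp. 38–39), endnote M.12; [Milne2020HodgeClassesAV] J. S. Milne, *Hodge classes on abelian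
varieties* (2020), 1.2 (a) and Theorem 1 (proof: "`a ∈ E` acts on `H^{2p}(A_Δ)_{Δ×{t}}` as multiplication by
`∏_{s∈Δ}(t∘s)(a)`"); [MoonenZarhin1998WeilClasses] §1; [Gordon1999HodgeAVSurvey] B. B. Gordon, 9.2.2 and §9.3;
[Milne1999LefschetzClasses] J. S. Milne, Duke Math. J. 96 (1999), Example 4.10 ("the Weil classes are exotic");
[LangeBirkenhake1992] Lemma 1.1.17.
-/

noncomputable section

namespace Summit.HodgeConjecture.CorCM.WeilLineWeightLines

open CategoryTheory CategoryTheory.Limits NumberField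
open Literature.AlgebraicTopology.SingularHomology
open Literature.AlgebraicGeometry Literature.AlgebraicGeometry.Motives Literature.AlgebraicGeometry.HodgeTheory
open Literature.AlgebraicGeometry.ComplexMultiplication
open Literature.AlgebraicGeometry.Pohlmann1968
open Literature.AlgebraicGeometry.Deligne1982
open Literature.AlgebraicGeometry.VanGeemen1994 (hodgeClassSpan)
open Literature.Barriers.HodgeConjecture (divisorClassesSpan)
open Literature.NumberTheory.Automorphic.PicardCM (eigenline)
open Summit.HodgeConjecture.HodgeConjecture.Theorems.HodgeAbelianVarieties.CMPivotAndre
open Summit.HodgeConjecture.CorCM.AndreProductForm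
open Summit.HodgeConjecture.CorCM.WeilLineMonomial

variable {K : Type} [Field K] [NumberField K]

/-! ## The full torus `∏_j 𝓞_K` on the eigen-line basis and on the monomials -/

section Torus

variable {d : ℕ} {A : Fin d → AbelianVariety ℂ} {act : ∀ j, 𝓞 K →+* End (A j)}
  {θ : ∀ j, K →+* Module.End ℂ (complexBetti (A j).X 1)} {Ψ : Fin d → CMType K}
  {v : ∀ j, Module.Basis (K →+* ℂ) ℂ (complexBetti (A j).X 1)}

/-- **The torus on the eigen-line basis of `H¹(⨁ A)`**: `(⊕_j act_j(a_j))^*` multiplies the line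
`(j, σ)` (`= π_j^* (v j σ)`) by `σ(a_j)` ("`e ∈ E` acts on `H¹(A_i)_s` as `s(e)`", slot by slot).
[cite: Milne2020HodgeClassesAV, 1.2 (a)] -/
theorem map_torus_biprodBasis (hA : ∀ j, IsCMTypeRealisation (Ψ j) (A j) (act j) (θ j))
    (hv : ∀ j σ, v j σ ∈ eigenline (θ j) σ) (a : Fin d → 𝓞 K) (j : Fin d) (σ : K →+* ℂ) :
    complexBetti.map (biproduct.map fun i => (act i (a i) : A i ⟶ A i)).hom.hom.hom 1
        (biprodBasis A v (j, σ)) =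
      σ (a j : K) • biprodBasis A v (j, σ) := by
  rw [biprodBasis_apply]
  change complexBetti.map (biproduct.map fun i => (act i (a i) : A i ⟶ A i)).hom.hom.hom 1
    (complexBetti.map (biproduct.π A j).hom.hom.hom 1 (v j σ)) = _
  rw [complexBetti_map_map_one_apply, biproduct.map_π, ← complexBetti_map_map_one_apply,
    map_ι_apply_of_mem_eigenline (hA j) (hv j σ), map_smul]

/-- **The torus on a monomial**: `(⊕_j act_j(a_j))^* μ_s = (∏_j s(a_j)) · μ_s` (pull-back is a ring
homomorphism; Milne: "`a ∈ E` acts on `H^{2p}(A_Δ)_{Δ×{t}}` as multiplication by `∏_{s∈Δ}(t∘s)(a)`", here for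
the whole CM algebra `E = K^{2m}`). [cite: Milne2020HodgeClassesAV, Theorem 1 (proof)] -/
theorem map_torus_monomial (hA : ∀ j, IsCMTypeRealisation (Ψ j) (A j) (act j) (θ j))
    (hv : ∀ j σ, v j σ ∈ eigenline (θ j) σ) (a : Fin d → 𝓞 K) (s : K →+* ℂ) :
    complexBetti.map (biproduct.map fun i => (act i (a i) : A i ⟶ A i)).hom.hom.hom d (monomial A v s) =
      (∏ j : Fin d, s (a j : K)) • monomial A v s := by
  rw [monomial_def, complexBetti_map_cupPowOne]
  have e : (fun j => complexBetti.map (biproduct.map fun i => (act i (a i) : A i ⟶ A i)).hom.hom.hom 1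
      (biprodBasis A v (j, s))) = fun j => (s (a j : K)) • biprodBasis A v (j, s) :=
    funext fun j => map_torus_biprodBasis hA hv a j s
  rw [e, MultilinearMap.map_smul_univ]

end Torus

/-! ## The monomial line of `s` is the Pohlmann weight line of the Weil weight `Δ × {s}` -/

section WeightLines

variable {m : ℕ} {A : Fin (2 * m) → AbelianVariety ℂ} {ι : ∀ j, 𝓞 K →+* End (A j)}
  {θ : ∀ j, K →+* Module.End ℂ (complexBetti (A j).X 1)} {Φ : Fin (2 * m) → CMType K}
  {v : ∀ j, Module.Basis (K →+* ℂ) ℂ (complexBetti (A j).X 1)}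

omit [NumberField K] in
/-- The character of the Weil weight of `s` on the torus: `∏_{(j,t) ∈ Δ×{s}} t(a_j) = ∏_j s(a_j)`.
[cite: Milne2020HodgeClassesAV, Theorem 1 (proof)] -/
theorem prod_weilWeight_apply (a : Fin (2 * m) → 𝓞 K) (s : K →+* ℂ) :
    (∏ x ∈ weilWeight m s, x.2 ((a x.1 : 𝓞 K) : K)) = ∏ j : Fin (2 * m), s (a j : K) := by
  rw [weilWeight, colWeight, Finset.prod_map]
  rfl

/-- **A monomial is a weight class of its Weil weight**: `μ_s ∈ H^{2m}(B)_{Δ×{s}}` — the full torus acts on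
`μ_s` by the character of `Δ × {s}`. [cite: Milne2020HodgeClassesAV, 1.2 (a) and Theorem 1 (proof)]
[cite: Deligne1982HodgeCycles, I §5 (c) (p. 38)] -/
theorem monomial_mem_weightClassesAlg_weilWeight (hA : ∀ j, IsCMTypeRealisation (Φ j) (A j) (ι j) (θ j))
    (hv : ∀ j σ, v j σ ∈ eigenline (θ j) σ) (s : K →+* ℂ) :
    monomial A v s ∈ weightClassesAlg (K := fun _ : Fin (2 * m) => K) A ι (2 * m) (weilWeight m s) := by
  refine mem_weightClassesAlg_iff.2 fun a => ?_
  convert map_torus_monomial hA hv (fun j => a j) s using 2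
  exact prod_weilWeight_apply (fun j => a j) s

/-- The monomial line lies in the weight line. [cite: Milne2020HodgeClassesAV, 1.2 (a)] -/
theorem span_monomial_le_weightClassesAlg_weilWeight (hA : ∀ j, IsCMTypeRealisation (Φ j) (A j) (ι j) (θ j))
    (hv : ∀ j σ, v j σ ∈ eigenline (θ j) σ) (s : K →+* ℂ) :
    (ℂ ∙ monomial A v s) ≤ weightClassesAlg (K := fun _ : Fin (2 * m) => K) A ι (2 * m) (weilWeight m s) :=
  (Submodule.span_singleton_le_iff_mem _ _).2 (monomial_mem_weightClassesAlg_weilWeight hA hv s)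

/-- **`ℂ · μ_s = H^{2m}(B)_{Δ×{s}}`**: the monomial line of the embedding `s` IS the Pohlmann weight line of the
Weil weight `Δ × {s}` (inclusion, and both are lines: `μ_s ≠ 0`, `Deligne1982.finrank_weightClassesAlg_weilWeight`).
[cite: Milne2020HodgeClassesAV, 1.2 (a)] [cite: Deligne1982HodgeCycles, I Prop. 4.4 (p. 30)] -/
theorem span_monomial_eq_weightClassesAlg_weilWeight (hA : ∀ j, IsCMTypeRealisation (Φ j) (A j) (ι j) (θ j))
    (hv : ∀ j σ, v j σ ∈ eigenline (θ j) σ) (s : K →+* ℂ) :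
    (ℂ ∙ monomial A v s) = weightClassesAlg (K := fun _ : Fin (2 * m) => K) A ι (2 * m) (weilWeight m s) := by
  have h1 : Module.finrank ℂ
      ↥(weightClassesAlg (K := fun _ : Fin (2 * m) => K) A ι (2 * m) (weilWeight m s)) = 1 :=
    finrank_weightClassesAlg_weilWeight hA s
  haveI : FiniteDimensional ℂ
      ↥(weightClassesAlg (K := fun _ : Fin (2 * m) => K) A ι (2 * m) (weilWeight m s)) :=
    Module.finite_of_finrank_pos (by rw [h1]; exact Nat.one_pos)
  exact Submodule.eq_of_le_of_finrank_eq (span_monomial_le_weightClassesAlg_weilWeight hA hv s)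
    (by rw [finrank_span_singleton (monomial_ne_zero A v s), h1])

/-! ## Deligne's Weil space is the sum of the Weil weight lines -/

/-- **`weilLineClasses B ι (2m) = ⨆_s H^{2m}(B)_{Δ×{s}}`** for every family `(A_j, ι_j, θ_j)_{j<2m}` of
realisations of CM types `Φ_j` of `K`: the `K`-Weil-line space of the diagonal action (André's product form,
Milne's `W_F(A_Δ) ⊗ ℂ`, Deligne's `⋀^d_E H¹(A) ⊗ ℂ`) is the sum of the Pohlmann weight lines of the `[K:ℚ]` Weil
weights.  (`≤`: the `s`-summand is the monomial line `ℂ · μ_s`, which is the weight line; `≥`: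
`Deligne1982.weightClassesAlg_weilWeight_le_weilLineClasses`.) [cite: Deligne1982HodgeCycles, I §5 (c) (pp. 38–39)]
[cite: Milne2020HodgeClassesAV, 1.2 (a) and Theorem 1 (proof)] [cite: MoonenZarhin1998WeilClasses, §1] -/
theorem weilLineClasses_eq_iSup_weightClassesAlg_weilWeight
    (hA : ∀ j, IsCMTypeRealisation (Φ j) (A j) (ι j) (θ j)) :
    weilLineClasses A ι (2 * m) =
      ⨆ s : K →+* ℂ, weightClassesAlg (K := fun _ : Fin (2 * m) => K) A ι (2 * m) (weilWeight m s) := by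
  choose v hv using fun j => AndreProductForm.exists_eigenbasis (hA j)
  rw [weilLineClasses_eq_iSup_span_monomial hA hv]
  exact iSup_congr fun s => span_monomial_eq_weightClassesAlg_weilWeight hA hv s

/-! ## Consequences for the whole Weil space -/

/-- **Deligne, §5 (c) "In summary", Hodge part, for the whole space**: if `Σ_j Φ_j` is constant (`= m`), then
`⋀^{2m}_K H¹(B) ⊗ ℂ ⊆ Bᵐ(B) ⊗ ℂ` — every class in the `K`-Weil-line space of `B = ⨁_j A_j` is a `ℂ`-combination
of rational `(m,m)` classes ("`⋀^d_E H¹(A, ℚ)(d/2) ⊂ H^d(A, ℚ)(d/2)` consists of [absolute] Hodge cycles"; the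
tree had this line by line, `Deligne1982.weightClassesAlg_weilWeight_le_hodgeClassSpan`).
[cite: Deligne1982HodgeCycles, I §5 (c) (pp. 38–39) and Prop. 4.4 (p. 30)] -/
theorem weilLineClasses_le_hodgeClassSpan (hA : ∀ j, IsCMTypeRealisation (Φ j) (A j) (ι j) (θ j))
    (hsum : ∀ t : K →+* ℂ, {j : Fin (2 * m) | t ∈ (Φ j).1}.ncard = m) :
    weilLineClasses A ι (2 * m) ≤ hodgeClassSpan (⨁ A).dim (⨁ A).X m := by
  rw [weilLineClasses_eq_iSup_weightClassesAlg_weilWeight hA]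
  exact iSup_le fun s => weightClassesAlg_weilWeight_le_hodgeClassSpan hA hsum s

/-- **The whole Weil space is divisorial iff the family is conjugation-symmetric**:
`⋀^{2m}_K H¹(B) ⊗ ℂ ⊆ Dᵐ(B) ⊗ ℂ` (the span of `m`-fold products of rational `(1,1)` classes) iff
`d(Ψ) = d(Ψ̄)` for every CM type `Ψ` (Deligne's multiplicities `typeCount`); otherwise NO Weil weight line is
divisorial ("the Weil classes are exotic").  Line by line this is
`Deligne1982.weightClassesAlg_weilWeight_le_divisorClassesSpan_iff`, whose right-hand side does not depend on `s`.
[cite: Gordon1999HodgeAVSurvey, 9.2.2 and §9.3] [cite: Deligne1982HodgeCycles, I §5 (c) and Lemma 5.2 (pp. 38–40)] -/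
theorem weilLineClasses_le_divisorClassesSpan_iff (hA : ∀ j, IsCMTypeRealisation (Φ j) (A j) (ι j) (θ j)) :
    weilLineClasses A ι (2 * m) ≤ divisorClassesSpan (⨁ A).X (⨁ A).dim m ↔
      ∀ S, typeCount Φ S = typeCount Φ Sᶜ := by
  rw [weilLineClasses_eq_iSup_weightClassesAlg_weilWeight hA, iSup_le_iff]
  constructor
  · intro h
    obtain ⟨s⟩ := (inferInstance : Nonempty (K →+* ℂ))
    exact (weightClassesAlg_weilWeight_le_divisorClassesSpan_iff hA s).1 (h s)
  · intro h s
    exact (weightClassesAlg_weilWeight_le_divisorClassesSpan_iff hA s).2 h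

/-- **One divisorial Weil line forces the whole Weil space into `Dᵐ ⊗ ℂ`** (the criterion is the same for every
embedding `s`). [cite: Gordon1999HodgeAVSurvey, 9.2.2] [cite: Deligne1982HodgeCycles, I Lemma 5.2 (p. 40)] -/
theorem weilLineClasses_le_divisorClassesSpan_of_weightClassesAlg_le
    (hA : ∀ j, IsCMTypeRealisation (Φ j) (A j) (ι j) (θ j)) {s : K →+* ℂ}
    (h : weightClassesAlg (K := fun _ : Fin (2 * m) => K) A ι (2 * m) (weilWeight m s) ≤
      divisorClassesSpan (⨁ A).X (⨁ A).dim m) :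
    weilLineClasses A ι (2 * m) ≤ divisorClassesSpan (⨁ A).X (⨁ A).dim m :=
  (weilLineClasses_le_divisorClassesSpan_iff hA).2
    ((weightClassesAlg_weilWeight_le_divisorClassesSpan_iff hA s).1 h)

/-- **No Weil line divisorial ⟹ the whole Weil space meets `Dᵐ ⊗ ℂ` trivially.**  If `d(Ψ) ≠ d(Ψ̄)` for some
type `Ψ`, then `⋀^{2m}_K H¹(B) ⊗ ℂ ∩ (Dᵐ(B) ⊗ ℂ) = 0`: in a cup-monomial eigenbasis of `H^{2m}(B)`
(`Pohlmann1968.exists_eigenbasis_biproduct`, `exists_monomialBasis`) the Weil space is spanned by the monomials of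
the Weil weights and `Dᵐ ⊗ ℂ` by those of the Pohlmann divisor weights
(`Pohlmann1968.divisorClassesSpan_biproduct_eq_iSup`), and no Weil weight is a divisor weight
(`Deligne1982.weilWeight_mem_pohlmannDivisorSetsAlg_iff`) — two disjoint sub-families of one basis span disjoint
subspaces.  This is the honest content of "the Weil classes are exotic" for the whole space: not merely
`⊄ Dᵐ ⊗ ℂ`, but no non-zero class of the Weil space is a combination of products of divisor classes.
[cite: Gordon1999HodgeAVSurvey, 9.2.2 and §9.3] [cite: Milne1999LefschetzClasses, Example 4.10]
[cite: Deligne1982HodgeCycles, I §5 (c) and Lemma 5.2 (pp. 38–40)] -/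
theorem disjoint_weilLineClasses_divisorClassesSpan (hA : ∀ j, IsCMTypeRealisation (Φ j) (A j) (ι j) (θ j))
    (hne : ∃ S, typeCount Φ S ≠ typeCount Φ Sᶜ) :
    Disjoint (weilLineClasses A ι (2 * m)) (divisorClassesSpan (⨁ A).X (⨁ A).dim m) := by
  classical
  letI : LinearOrder ((_ : Fin (2 * m)) × (K →+* ℂ)) :=
    LinearOrder.lift' (Fintype.equivFin _) (Fintype.equivFin _).injective
  obtain ⟨w, hw, -, -⟩ := exists_eigenbasis_biproduct (K := fun _ : Fin (2 * m) => K) hA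
  obtain ⟨b, hb⟩ := exists_monomialBasis w (2 * m)
  have hW : weilLineClasses A ι (2 * m) = Submodule.span ℂ
      (b '' {u | (u : Finset ((_ : Fin (2 * m)) × (K →+* ℂ))) ∈ Set.range (weilWeight (K := K) m)}) := by
    rw [weilLineClasses_eq_iSup_weightClassesAlg_weilWeight hA,
      show (⨆ s : K →+* ℂ, weightClassesAlg (K := fun _ : Fin (2 * m) => K) A ι (2 * m) (weilWeight m s)) =
          ⨆ S ∈ Set.range (weilWeight (K := K) m),
            weightClassesAlg (K := fun _ : Fin (2 * m) => K) A ι (2 * m) S from iSup_range.symm]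
    exact iSup_weightClassesAlg_eq_span_image (K := fun _ : Fin (2 * m) => K) hw hb
      (by rintro S ⟨s, rfl⟩; exact card_weilWeight s)
  have hD : divisorClassesSpan (⨁ A).X (⨁ A).dim m = Submodule.span ℂ
      (b '' {u | (u : Finset ((_ : Fin (2 * m)) × (K →+* ℂ))) ∈
        pohlmannDivisorSetsAlg (K := fun _ : Fin (2 * m) => K) Φ m}) := by
    rw [divisorClassesSpan_biproduct_eq_iSup (K := fun _ : Fin (2 * m) => K) hA m]
    exact iSup_weightClassesAlg_eq_span_image (K := fun _ : Fin (2 * m) => K) hw hb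
      fun S hS => (pohlmannDivisorSetsAlg_subset_pohlmannSetsAlg _ m hS).1
  rw [hW, hD]
  refine b.linearIndependent.disjoint_span_image (Set.disjoint_left.2 ?_)
  rintro u ⟨s, hs⟩ hu
  obtain ⟨S, hS⟩ := hne
  have hu' : weilWeight m s ∈ pohlmannDivisorSetsAlg (K := fun _ : Fin (2 * m) => K) Φ m := by
    rw [hs]; exact hu
  exact hS ((weilWeight_mem_pohlmannDivisorSetsAlg_iff Φ s).1 hu' S)

/-- **Dichotomy for Deligne's Weil space**: it lies in the divisor ring `Dᵐ(B) ⊗ ℂ` (conjugation-symmetric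
family) or meets it trivially (otherwise) — the criterion `d(Ψ) = d(Ψ̄) ∀Ψ` is the same for every Weil line.
[cite: Gordon1999HodgeAVSurvey, 9.2.2 and §9.3] [cite: Deligne1982HodgeCycles, I §5 (c) and Lemma 5.2 (pp. 38–40)] -/
theorem weilLineClasses_le_or_disjoint_divisorClassesSpan
    (hA : ∀ j, IsCMTypeRealisation (Φ j) (A j) (ι j) (θ j)) :
    weilLineClasses A ι (2 * m) ≤ divisorClassesSpan (⨁ A).X (⨁ A).dim m ∨
      Disjoint (weilLineClasses A ι (2 * m)) (divisorClassesSpan (⨁ A).X (⨁ A).dim m) := by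
  by_cases h : ∀ S, typeCount Φ S = typeCount Φ Sᶜ
  · exact Or.inl ((weilLineClasses_le_divisorClassesSpan_iff hA).2 h)
  · push Not at h
    exact Or.inr (disjoint_weilLineClasses_divisorClassesSpan hA h)

/-- The Weil space is non-zero (it contains the monomials `μ_s ≠ 0`). [cite: Deligne1982HodgeCycles, I Prop. 4.4 (p. 30)] -/
theorem weilLineClasses_ne_bot (hA : ∀ j, IsCMTypeRealisation (Φ j) (A j) (ι j) (θ j)) :
    weilLineClasses A ι (2 * m) ≠ ⊥ := by
  choose v hv using fun j => AndreProductForm.exists_eigenbasis (hA j)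
  obtain ⟨s⟩ := (inferInstance : Nonempty (K →+* ℂ))
  intro h
  exact monomial_ne_zero A v s ((Submodule.eq_bot_iff _).1 h _ (monomial_mem_weilLineClasses hA hv s))

/-- **Exotic Weil space**: for a constant-sum family that is not a union of conjugate pairs (`d(Ψ) ≠ d(Ψ̄)` for
some `Ψ`) Deligne's Weil space is a NON-ZERO subspace of `Bᵐ(B) ⊗ ℂ` meeting `Dᵐ(B) ⊗ ℂ` trivially — these are the
Hodge classes for which §5 needs Thm. 4.8 rather than divisors. [cite: Deligne1982HodgeCycles, I §5 (c) (pp. 38–39)]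
[cite: Gordon1999HodgeAVSurvey, 9.2.2 and §9.3] [cite: Milne1999LefschetzClasses, Example 4.10] -/
theorem weilLineClasses_exotic (hA : ∀ j, IsCMTypeRealisation (Φ j) (A j) (ι j) (θ j))
    (hsum : ∀ t : K →+* ℂ, {j : Fin (2 * m) | t ∈ (Φ j).1}.ncard = m) (hne : ∃ S, typeCount Φ S ≠ typeCount Φ Sᶜ) :
    weilLineClasses A ι (2 * m) ≠ ⊥ ∧
      weilLineClasses A ι (2 * m) ≤ hodgeClassSpan (⨁ A).dim (⨁ A).X m ∧
      Disjoint (weilLineClasses A ι (2 * m)) (divisorClassesSpan (⨁ A).X (⨁ A).dim m) :=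
  ⟨weilLineClasses_ne_bot hA, weilLineClasses_le_hodgeClassSpan hA hsum,
    disjoint_weilLineClasses_divisorClassesSpan hA hne⟩

/-- In particular the exotic Weil space is not contained in `Dᵐ ⊗ ℂ`. [cite: Gordon1999HodgeAVSurvey, 9.2.2] -/
theorem not_weilLineClasses_le_divisorClassesSpan (hA : ∀ j, IsCMTypeRealisation (Φ j) (A j) (ι j) (θ j))
    (hne : ∃ S, typeCount Φ S ≠ typeCount Φ Sᶜ) :
    ¬ weilLineClasses A ι (2 * m) ≤ divisorClassesSpan (⨁ A).X (⨁ A).dim m := fun h =>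
  weilLineClasses_ne_bot hA ((disjoint_weilLineClasses_divisorClassesSpan hA hne).eq_bot_of_le h)

/-- **`dim_ℂ (⋀^{2m}_K H¹(B) ⊗ ℂ) = [K:ℚ]`** for `m ≥ 1`, free of eigenbases (p2's
`WeilLineMonomial.finrank_weilLineClasses` with the eigenbases supplied by the realisations).
[cite: Deligne1982HodgeCycles, I Prop. 4.4 (p. 30)] [cite: MoonenZarhin1998WeilClasses, §1] -/
theorem finrank_weilLineClasses_eq (hA : ∀ j, IsCMTypeRealisation (Φ j) (A j) (ι j) (θ j)) (hm : 0 < m) :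
    Module.finrank ℂ ↥(weilLineClasses A ι (2 * m)) = Module.finrank ℚ K := by
  choose v hv using fun j => AndreProductForm.exists_eigenbasis (hA j)
  exact finrank_weilLineClasses hA hv (by omega)

end WeightLines

end Summit.HodgeConjecture.CorCM.WeilLineWeightLines

end
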